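import Mathlib
import HarnessLib

/-!
# Line «sandwich_discharge» on crux `HistoryTailL` (stmt-QuantumFields-19936), stub `stub_sandwichSweepGapCapped` (S′), B6 door item (η) —
# «THE EXPONENT ROWS»: under the severity CAP `x ≤ (151·L²·L⁻¹⁹)^j` and the threshold ratio `θ_K ≤ 2^{p₀}·L^{−j∕2}·θ`, every remainder of the B6 knit
# is `≤ (explicit)·4^{p₀}·Γ^j·L^{e·m}∕L^{a·j}·θ` (signal rows) or `≤ (explicit)·4^{p₀}·Γ^j·L^{e·m}∕L^{a·j}` (cost rows) with `Γ < 3^a`, hence eventually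
# (in `j`) below any `ε > 0` for every `L ≥ 3`

Cell `ym3-torus` (YM ladder rung R3 = continuum SU(2) Yang–Mills on the three-torus — a RUNG, NOT the Clay problem: not d = 4, not infinite volume,
not a mass gap); WIDTH helper seat `ym3-torus-px6` gen 8; `--supports stmt-QuantumFields-19936` (helper).  THEOREMS ONLY (0 `def`, default heartbeats).

WHY (px8 g7 «B6 DOOR v3» D7∕D8 and the bus word 12:49:35Z «(η) → px6 — SHAPES BELOW»).  The door's knit (✓`CovariantDischargeKnitSocket.capped_gap_of_sweep`)
needs every signal error to be a FRACTION of the signal `θ := θ(b)(K−j)` and every cost excess to be `o(1)`, uniformly in the field, for `j > j₀`.  All rows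
are PURE REAL ALGEBRA in the door's symbols, which enter here as free reals with hypotheses: `θ` (signal threshold), `x := θ(Λb)(K−j)` with `θ ≤ x`,
`θK := θ(b)(K)` with (iii) ✓`CovariantDischargeThresholdRatio`: `θK ≤ 2^{p₀}·√(L⁻¹)^j·θ`, the CAP of record ✓`CovariantDischargeSandwichCapThreshold.θBal_cap_le_pow`
at `M := 19`: `x ≤ (151·L²·(L⁻¹)^19)^j`, the profile radius `R = N_R·L^(2j+h)` (`h = j + m`, `1 ≤ N_R`), and FILE 8's absolute constants `A_… ≥ 0`.
* §0 power bookkeeping: `(2^{p₀})² = 4^{p₀}`, `(√(L⁻¹)^j)² = (L^j)⁻¹`, the CAP rewritten `(151·L²·(L⁻¹)^19)^j = 151^j∕L^(17j)`, and the two squares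
  `θK² ≤ 4^{p₀}·(L^j)⁻¹·θ·x`, `θK² ≤ 4^{p₀}·(L^j)⁻¹·x²`;
* §1 THREE MONOMIAL CORES: `core_R3 : R³·L^(2j)·θK² ≤ N_R³·4^{p₀}·151^j·(L^(3m)∕L^(7j))·θ`, `core_400 : 400^j·L^(6j)·θK² ≤ 4^{p₀}·60400^j·θ∕L^(12j)` (and the
  height-`h` twin with `400^m·L^(6m)`), `core_R5 : R⁵·L^(3j)·θK² ≤ N_R⁵·4^{p₀}·22801^j·L^(5m)∕L^(17j)`;
* §2 THE ROWS AS THE DOOR PRODUCES THEM: (η1) BULK `(η_F∕3)·(A_B + A_B′(2R + 2L^h))·4L^(2j)`, `η_F = √3(60θK² + 6(49R²θK)θK)` ⟶ `C₁ = 1888√3`, `Γ = 151`, `a = 7`, `e = 3`;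
  (η2) (r2)-DEFECT `2θK·(2·16·169·R²·θK·A₁·R·L^(2j))` ⟶ `C₂ = 10816`, same shape; (η3) READING ERRORS `E_j = 100√3(20L)^(2j)(175L^(2j)θK)²` ⟶ `C₃ = 3062500√3`,
  `Γ = 60400`, `a = 12`, and `L^(−2m)·E_h` ⟶ extra `400^m·L^(4m)`; (η4) COST-DEFECT `320·A_T·A₁·(169R²θK)²·R·L^(4j)∕L^j` ⟶ `C₄ = 9139520`, `Γ = 22801 = 151²`, `a = 17`, `e = 5`;
  (η5) the (P″) error row `24√3·A_S·θK·L^(2j+h)∕R ≤ θ∕64` as soon as `1536√3·2^{p₀}·A_S ≤ N_R`;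
* §3 SMALLNESS: ★`exists_forall_mul_pow_le` (`0 ≤ q < 1` ⇒ `A·q^j ≤ ε` for `j > j₀`), `div_pow_lt_one` (`3 ≤ L`, `Γ < 3^a` ⇒ `Γ∕L^a < 1`), and the template
  ★`exists_forall_row_le` (`C·Γ^j·L^(e·m)∕L^(a·j) ≤ ε` for `j > j₀(L, C, m, ε)`), with `151 < 3^7`, `60400 < 3^12`, `22801 < 3^17` recorded by `norm_num`.
HONEST SCOPE: real arithmetic; the numeric prefactors are whatever the algebra gives (stated explicitly); NOTHING here proves the capped stub, `HistoryTailL`,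
or any summit statement; YM₃ on T³ is rung R3, not Clay. [folklore]
-/

noncomputable section

namespace Summit.QuantumFields.YangMills.Theorems.CovariantDischargeDoorExponentRows

/-! ## §0 Power bookkeeping -/

/-- `2^{p₀}·2^{p₀} = 4^{p₀}` (`Real.rpow`). [folklore] -/
theorem two_rpow_mul_two_rpow (p₀ : ℝ) : (2 : ℝ) ^ p₀ * (2 : ℝ) ^ p₀ = (4 : ℝ) ^ p₀ := by
  rw [← Real.mul_rpow (by norm_num) (by norm_num)]; norm_num

/-- `(√(L⁻¹)^j)² = (L^j)⁻¹`. [folklore] -/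
theorem sqrt_inv_pow_sq (L : ℕ) (j : ℕ) : (Real.sqrt ((L : ℝ)⁻¹) ^ j) ^ 2 = ((L : ℝ) ^ j)⁻¹ := by
  rw [← pow_mul, mul_comm, pow_mul, Real.sq_sqrt (inv_nonneg.mpr (Nat.cast_nonneg L)), inv_pow]

/-- THE CAP REWRITTEN: `(151·L²·(L⁻¹)^19)^j = 151^j ∕ L^(17j)` (`L ≥ 1`). [folklore] -/
theorem cap_pow_eq {L : ℕ} (hL : 1 ≤ L) (j : ℕ) :
    (151 * (L : ℝ) ^ 2 * ((L : ℝ)⁻¹) ^ 19) ^ j = (151 : ℝ) ^ j / (L : ℝ) ^ (17 * j) := by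
  have hL1 : (1 : ℝ) ≤ L := by exact_mod_cast hL
  have hL0 : (L : ℝ) ≠ 0 := by positivity
  have h1 : (L : ℝ) ^ 2 * ((L : ℝ)⁻¹) ^ 19 = ((L : ℝ) ^ 17)⁻¹ := by
    rw [inv_pow, show (L : ℝ) ^ 19 = (L : ℝ) ^ 2 * (L : ℝ) ^ 17 by rw [← pow_add], mul_inv, ← mul_assoc,
      mul_inv_cancel₀ (pow_ne_zero _ hL0), one_mul]
  rw [mul_assoc, h1, mul_pow, inv_pow, ← pow_mul, div_eq_mul_inv]

/-- **`θK² ≤ 4^{p₀}·(L^j)⁻¹·θ²`** from the threshold ratio `θK ≤ 2^{p₀}·√(L⁻¹)^j·θ` (`θK ≥ 0`). [folklore] -/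
theorem sq_le_of_ratio {L : ℕ} {p₀ θ θK : ℝ} {j : ℕ} (hθK0 : 0 ≤ θK) (hθK : θK ≤ (2 : ℝ) ^ p₀ * Real.sqrt ((L : ℝ)⁻¹) ^ j * θ) :
    θK ^ 2 ≤ (4 : ℝ) ^ p₀ * ((L : ℝ) ^ j)⁻¹ * θ ^ 2 := by
  have h := pow_le_pow_left₀ hθK0 hθK 2
  calc θK ^ 2 ≤ ((2 : ℝ) ^ p₀ * Real.sqrt ((L : ℝ)⁻¹) ^ j * θ) ^ 2 := h
    _ = ((2 : ℝ) ^ p₀ * (2 : ℝ) ^ p₀) * (Real.sqrt ((L : ℝ)⁻¹) ^ j) ^ 2 * θ ^ 2 := by ring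
    _ = (4 : ℝ) ^ p₀ * ((L : ℝ) ^ j)⁻¹ * θ ^ 2 := by rw [two_rpow_mul_two_rpow, sqrt_inv_pow_sq]

/-- **`θK² ≤ 4^{p₀}·(L^j)⁻¹·θ·x`** (`0 ≤ θ ≤ x`). [folklore] -/
theorem sq_le_theta_mul_x {L : ℕ} {p₀ θ x θK : ℝ} {j : ℕ} (hθ : 0 ≤ θ) (hθx : θ ≤ x) (hθK0 : 0 ≤ θK)
    (hθK : θK ≤ (2 : ℝ) ^ p₀ * Real.sqrt ((L : ℝ)⁻¹) ^ j * θ) : θK ^ 2 ≤ (4 : ℝ) ^ p₀ * ((L : ℝ) ^ j)⁻¹ * (θ * x) := by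
  refine (sq_le_of_ratio hθK0 hθK).trans (mul_le_mul_of_nonneg_left ?_ (by positivity))
  rw [sq]; exact mul_le_mul_of_nonneg_left hθx hθ

/-- **`θK² ≤ 4^{p₀}·(L^j)⁻¹·x²`** (`0 ≤ θ ≤ x`). [folklore] -/
theorem sq_le_x_sq {L : ℕ} {p₀ θ x θK : ℝ} {j : ℕ} (hθ : 0 ≤ θ) (hθx : θ ≤ x) (hθK0 : 0 ≤ θK)
    (hθK : θK ≤ (2 : ℝ) ^ p₀ * Real.sqrt ((L : ℝ)⁻¹) ^ j * θ) : θK ^ 2 ≤ (4 : ℝ) ^ p₀ * ((L : ℝ) ^ j)⁻¹ * x ^ 2 :=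
  (sq_le_of_ratio hθK0 hθK).trans (mul_le_mul_of_nonneg_left (pow_le_pow_left₀ hθ hθx 2) (by positivity))

/-! ## §1 The three monomial cores -/

section Cores

variable {L : ℕ} {p₀ θ x θK R N_R : ℝ} {j m h : ℕ}

/-- ★ **CORE `R³`**: `R³·L^(2j)·θK² ≤ N_R³·4^{p₀}·151^j·(L^(3m)∕L^(7j))·θ` under the CAP and the ratio (`R = N_R·L^(2j+h)`, `h = j + m`). [folklore] -/
theorem core_R3 (hL : 1 ≤ L) (hθ : 0 ≤ θ) (hθx : θ ≤ x) (hθK0 : 0 ≤ θK) (hθK : θK ≤ (2 : ℝ) ^ p₀ * Real.sqrt ((L : ℝ)⁻¹) ^ j * θ)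
    (hx : x ≤ (151 * (L : ℝ) ^ 2 * ((L : ℝ)⁻¹) ^ 19) ^ j) (hNR : 0 ≤ N_R) (hh : h = j + m) (hR : R = N_R * (L : ℝ) ^ (2 * j + h)) :
    R ^ 3 * (L : ℝ) ^ (2 * j) * θK ^ 2 ≤ N_R ^ 3 * (4 : ℝ) ^ p₀ * (151 : ℝ) ^ j * ((L : ℝ) ^ (3 * m) / (L : ℝ) ^ (7 * j)) * θ := by
  have hL1 : (1 : ℝ) ≤ L := by exact_mod_cast hL
  have hL0 : (0 : ℝ) < L := by linarith
  rw [cap_pow_eq hL] at hx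
  -- `θK² ≤ 4^p₀ (L^j)⁻¹ θ x ≤ 4^p₀ (L^j)⁻¹ θ · 151^j / L^(17j)`
  have hsq : θK ^ 2 ≤ (4 : ℝ) ^ p₀ * ((L : ℝ) ^ j)⁻¹ * (θ * ((151 : ℝ) ^ j / (L : ℝ) ^ (17 * j))) :=
    (sq_le_theta_mul_x hθ hθx hθK0 hθK).trans
      (mul_le_mul_of_nonneg_left (mul_le_mul_of_nonneg_left hx hθ) (by positivity))
  have hR3 : R ^ 3 * (L : ℝ) ^ (2 * j) = N_R ^ 3 * (L : ℝ) ^ (11 * j + 3 * m) := by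
    have hp : ((L : ℝ) ^ (2 * j + (j + m))) ^ 3 * (L : ℝ) ^ (2 * j) = (L : ℝ) ^ (11 * j + 3 * m) := by
      rw [← pow_mul, ← pow_add]; ring_nf
    rw [hR, hh, mul_pow, mul_assoc, hp]
  rw [hR3]
  have hmono : 0 ≤ N_R ^ 3 * (L : ℝ) ^ (11 * j + 3 * m) := by positivity
  calc N_R ^ 3 * (L : ℝ) ^ (11 * j + 3 * m) * θK ^ 2
      ≤ N_R ^ 3 * (L : ℝ) ^ (11 * j + 3 * m) * ((4 : ℝ) ^ p₀ * ((L : ℝ) ^ j)⁻¹ * (θ * ((151 : ℝ) ^ j / (L : ℝ) ^ (17 * j)))) :=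
        mul_le_mul_of_nonneg_left hsq hmono
    _ = N_R ^ 3 * (4 : ℝ) ^ p₀ * (151 : ℝ) ^ j * ((L : ℝ) ^ (3 * m) / (L : ℝ) ^ (7 * j)) * θ := by
        have key : (L : ℝ) ^ (11 * j + 3 * m) = (L : ℝ) ^ (3 * m) * (L : ℝ) ^ j * (L : ℝ) ^ (10 * j) := by
          rw [← pow_add, ← pow_add]; ring_nf
        have key2 : (L : ℝ) ^ (17 * j) = (L : ℝ) ^ (7 * j) * (L : ℝ) ^ (10 * j) := by
          rw [← pow_add]; ring_nf
        rw [key, key2]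
        field_simp

/-- ★ **CORE `400`**: `400^j·L^(6j)·θK² ≤ 4^{p₀}·60400^j·θ∕L^(12j)` under the CAP and the ratio. [folklore] -/
theorem core_400 (hL : 1 ≤ L) (hθ : 0 ≤ θ) (hθx : θ ≤ x) (hθK0 : 0 ≤ θK) (hθK : θK ≤ (2 : ℝ) ^ p₀ * Real.sqrt ((L : ℝ)⁻¹) ^ j * θ)
    (hx : x ≤ (151 * (L : ℝ) ^ 2 * ((L : ℝ)⁻¹) ^ 19) ^ j) :
    (400 : ℝ) ^ j * (L : ℝ) ^ (6 * j) * θK ^ 2 ≤ (4 : ℝ) ^ p₀ * (60400 : ℝ) ^ j * (θ / (L : ℝ) ^ (12 * j)) := by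
  have hL1 : (1 : ℝ) ≤ L := by exact_mod_cast hL
  have hL0 : (0 : ℝ) < L := by linarith
  rw [cap_pow_eq hL] at hx
  have hsq : θK ^ 2 ≤ (4 : ℝ) ^ p₀ * ((L : ℝ) ^ j)⁻¹ * (θ * ((151 : ℝ) ^ j / (L : ℝ) ^ (17 * j))) :=
    (sq_le_theta_mul_x hθ hθx hθK0 hθK).trans
      (mul_le_mul_of_nonneg_left (mul_le_mul_of_nonneg_left hx hθ) (by positivity))
  calc (400 : ℝ) ^ j * (L : ℝ) ^ (6 * j) * θK ^ 2
      ≤ (400 : ℝ) ^ j * (L : ℝ) ^ (6 * j) * ((4 : ℝ) ^ p₀ * ((L : ℝ) ^ j)⁻¹ * (θ * ((151 : ℝ) ^ j / (L : ℝ) ^ (17 * j)))) :=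
        mul_le_mul_of_nonneg_left hsq (by positivity)
    _ = (4 : ℝ) ^ p₀ * (60400 : ℝ) ^ j * (θ / (L : ℝ) ^ (12 * j)) := by
        have key : (60400 : ℝ) ^ j = (400 : ℝ) ^ j * (151 : ℝ) ^ j := by rw [← mul_pow]; norm_num
        have key2 : (L : ℝ) ^ (17 * j) = (L : ℝ) ^ (6 * j) * (L : ℝ) ^ (11 * j) := by rw [← pow_add]; ring_nf
        have key3 : (L : ℝ) ^ (12 * j) = (L : ℝ) ^ j * (L : ℝ) ^ (11 * j) := by rw [← pow_add]; ring_nf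
        rw [key, key2, key3]
        field_simp

/-- **CORE `400` AT THE FAR HEIGHT `h = j + m`**: `400^h·L^(6h)·θK² ≤ 4^{p₀}·60400^j·400^m·θ·L^(6m)∕L^(12j)`. [folklore] -/
theorem core_400_far (hL : 1 ≤ L) (hθ : 0 ≤ θ) (hθx : θ ≤ x) (hθK0 : 0 ≤ θK) (hθK : θK ≤ (2 : ℝ) ^ p₀ * Real.sqrt ((L : ℝ)⁻¹) ^ j * θ)
    (hx : x ≤ (151 * (L : ℝ) ^ 2 * ((L : ℝ)⁻¹) ^ 19) ^ j) (hh : h = j + m) :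
    (400 : ℝ) ^ h * (L : ℝ) ^ (6 * h) * θK ^ 2 ≤ (4 : ℝ) ^ p₀ * (60400 : ℝ) ^ j * (400 : ℝ) ^ m * (θ * (L : ℝ) ^ (6 * m) / (L : ℝ) ^ (12 * j)) := by
  have hL1 : (1 : ℝ) ≤ L := by exact_mod_cast hL
  have hL0 : (0 : ℝ) < L := by linarith
  have hsplit : (400 : ℝ) ^ h * (L : ℝ) ^ (6 * h) = ((400 : ℝ) ^ m * (L : ℝ) ^ (6 * m)) * ((400 : ℝ) ^ j * (L : ℝ) ^ (6 * j)) := by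
    rw [hh, pow_add, show 6 * (j + m) = 6 * j + 6 * m by ring, pow_add]; ring
  rw [hsplit, mul_assoc]
  calc ((400 : ℝ) ^ m * (L : ℝ) ^ (6 * m)) * ((400 : ℝ) ^ j * (L : ℝ) ^ (6 * j) * θK ^ 2)
      ≤ ((400 : ℝ) ^ m * (L : ℝ) ^ (6 * m)) * ((4 : ℝ) ^ p₀ * (60400 : ℝ) ^ j * (θ / (L : ℝ) ^ (12 * j))) :=
        mul_le_mul_of_nonneg_left (core_400 hL hθ hθx hθK0 hθK hx) (by positivity)
    _ = (4 : ℝ) ^ p₀ * (60400 : ℝ) ^ j * (400 : ℝ) ^ m * (θ * (L : ℝ) ^ (6 * m) / (L : ℝ) ^ (12 * j)) := by ring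

/-- ★ **CORE `R⁵`**: `R⁵·L^(3j)·θK² ≤ N_R⁵·4^{p₀}·22801^j·(L^(5m)∕L^(17j))` under the CAP and the ratio (uses `θK² ≤ 4^{p₀}(L^j)⁻¹x²`; `22801 = 151²`). [folklore] -/
theorem core_R5 (hL : 1 ≤ L) (hθ : 0 ≤ θ) (hθx : θ ≤ x) (hθK0 : 0 ≤ θK) (hθK : θK ≤ (2 : ℝ) ^ p₀ * Real.sqrt ((L : ℝ)⁻¹) ^ j * θ)
    (hx : x ≤ (151 * (L : ℝ) ^ 2 * ((L : ℝ)⁻¹) ^ 19) ^ j) (hNR : 0 ≤ N_R) (hh : h = j + m) (hR : R = N_R * (L : ℝ) ^ (2 * j + h)) :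
    R ^ 5 * (L : ℝ) ^ (3 * j) * θK ^ 2 ≤ N_R ^ 5 * (4 : ℝ) ^ p₀ * (22801 : ℝ) ^ j * ((L : ℝ) ^ (5 * m) / (L : ℝ) ^ (17 * j)) := by
  have hL1 : (1 : ℝ) ≤ L := by exact_mod_cast hL
  have hL0 : (0 : ℝ) < L := by linarith
  have hx0 : 0 ≤ x := hθ.trans hθx
  rw [cap_pow_eq hL] at hx
  have hx2 : x ^ 2 ≤ ((151 : ℝ) ^ j / (L : ℝ) ^ (17 * j)) ^ 2 := pow_le_pow_left₀ hx0 hx 2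
  have hsq : θK ^ 2 ≤ (4 : ℝ) ^ p₀ * ((L : ℝ) ^ j)⁻¹ * (((151 : ℝ) ^ j / (L : ℝ) ^ (17 * j)) ^ 2) :=
    (sq_le_x_sq hθ hθx hθK0 hθK).trans (mul_le_mul_of_nonneg_left hx2 (by positivity))
  have hR5 : R ^ 5 * (L : ℝ) ^ (3 * j) = N_R ^ 5 * (L : ℝ) ^ (18 * j + 5 * m) := by
    have hp : ((L : ℝ) ^ (2 * j + (j + m))) ^ 5 * (L : ℝ) ^ (3 * j) = (L : ℝ) ^ (18 * j + 5 * m) := by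
      rw [← pow_mul, ← pow_add]; ring_nf
    rw [hR, hh, mul_pow, mul_assoc, hp]
  rw [hR5]
  calc N_R ^ 5 * (L : ℝ) ^ (18 * j + 5 * m) * θK ^ 2
      ≤ N_R ^ 5 * (L : ℝ) ^ (18 * j + 5 * m) * ((4 : ℝ) ^ p₀ * ((L : ℝ) ^ j)⁻¹ * (((151 : ℝ) ^ j / (L : ℝ) ^ (17 * j)) ^ 2)) :=
        mul_le_mul_of_nonneg_left hsq (by positivity)
    _ = N_R ^ 5 * (4 : ℝ) ^ p₀ * (22801 : ℝ) ^ j * ((L : ℝ) ^ (5 * m) / (L : ℝ) ^ (17 * j)) := by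
        have key : (22801 : ℝ) ^ j = (151 : ℝ) ^ j * (151 : ℝ) ^ j := by rw [← mul_pow]; norm_num
        have key2 : (L : ℝ) ^ (18 * j + 5 * m) = (L : ℝ) ^ (5 * m) * (L : ℝ) ^ j * (L : ℝ) ^ (17 * j) := by
          rw [← pow_add, ← pow_add]; ring_nf
        have key3 : ((151 : ℝ) ^ j / (L : ℝ) ^ (17 * j)) ^ 2 = (151 : ℝ) ^ j * (151 : ℝ) ^ j / ((L : ℝ) ^ (17 * j) * (L : ℝ) ^ (17 * j)) := by
          rw [div_pow, sq, sq]
        rw [key, key2, key3]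
        field_simp

end Cores

/-! ## §2 The rows as the door produces them -/

section Rows

variable {L : ℕ} {p₀ θ x θK R N_R : ℝ} {j m h : ℕ}

/-- `1 ≤ R` and `L^h ≤ R` for `R = N_R·L^(2j+h)`, `N_R ≥ 1`, `L ≥ 1`. [folklore] -/
theorem radius_bounds (hL : 1 ≤ L) (hNR : 1 ≤ N_R) (hR : R = N_R * (L : ℝ) ^ (2 * j + h)) : 1 ≤ R ∧ (L : ℝ) ^ h ≤ R := by
  have hL1 : (1 : ℝ) ≤ L := by exact_mod_cast hL
  have h1 : (1 : ℝ) ≤ (L : ℝ) ^ (2 * j + h) := one_le_pow₀ hL1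
  have h2 : (L : ℝ) ^ h ≤ (L : ℝ) ^ (2 * j + h) := pow_le_pow_right₀ hL1 (by omega)
  have hLh : (0 : ℝ) ≤ (L : ℝ) ^ h := by positivity
  rw [hR]
  constructor
  · nlinarith
  · nlinarith

/-- ★ **(η1) THE BULK ROW**: `(η_F∕3)·(A_B + A_B′·(2R + 2L^h))·4L^(2j) ≤ 1888√3·(A_B + A_B′)·N_R³·4^{p₀}·151^j·(L^(3m)∕L^(7j))·θ`,
`η_F := √3·(60θK² + 6·(49R²θK)·θK)` (`Γ = 151 < 3^7`, `a = 7`, `e = 3`). [folklore] -/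
theorem bulk_row_le (hL : 1 ≤ L) (hθ : 0 ≤ θ) (hθx : θ ≤ x) (hθK0 : 0 ≤ θK) (hθK : θK ≤ (2 : ℝ) ^ p₀ * Real.sqrt ((L : ℝ)⁻¹) ^ j * θ)
    (hx : x ≤ (151 * (L : ℝ) ^ 2 * ((L : ℝ)⁻¹) ^ 19) ^ j) (hNR : 1 ≤ N_R) (hh : h = j + m) (hR : R = N_R * (L : ℝ) ^ (2 * j + h))
    {A_B A_B' : ℝ} (hAB : 0 ≤ A_B) (hAB' : 0 ≤ A_B') :
    Real.sqrt 3 * (60 * θK ^ 2 + 6 * (49 * R ^ 2 * θK) * θK) / 3 * (A_B + A_B' * (2 * R + 2 * (L : ℝ) ^ h)) * (4 * (L : ℝ) ^ (2 * j))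
      ≤ 1888 * Real.sqrt 3 * (A_B + A_B') * (N_R ^ 3 * (4 : ℝ) ^ p₀ * (151 : ℝ) ^ j * ((L : ℝ) ^ (3 * m) / (L : ℝ) ^ (7 * j)) * θ) := by
  obtain ⟨hR1, hLhR⟩ := radius_bounds hL hNR hR
  have hL1 : (1 : ℝ) ≤ L := by exact_mod_cast hL
  have h3 : 0 ≤ Real.sqrt 3 := Real.sqrt_nonneg 3
  have hsq0 : 0 ≤ θK ^ 2 := sq_nonneg _
  -- `60θK² + 294R²θK² ≤ 354 R² θK²`
  have hηF : 60 * θK ^ 2 + 6 * (49 * R ^ 2 * θK) * θK ≤ 354 * (R ^ 2 * θK ^ 2) := by nlinarith [one_le_pow₀ hR1 (n := 2)]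
  -- `A_B + A_B'(2R + 2L^h) ≤ (A_B + A_B')·4R`
  have hbr : A_B + A_B' * (2 * R + 2 * (L : ℝ) ^ h) ≤ (A_B + A_B') * (4 * R) := by nlinarith
  have hcore := core_R3 hL hθ hθx hθK0 hθK hx (by linarith) hh hR
  have hL2j : (0 : ℝ) ≤ 4 * (L : ℝ) ^ (2 * j) := by positivity
  have hRθ : 0 ≤ R ^ 2 * θK ^ 2 := by positivity
  have hY0 : 0 ≤ A_B + A_B' * (2 * R + 2 * (L : ℝ) ^ h) := by positivity
  have hX : Real.sqrt 3 * (60 * θK ^ 2 + 6 * (49 * R ^ 2 * θK) * θK) / 3 ≤ Real.sqrt 3 * (354 * (R ^ 2 * θK ^ 2)) / 3 :=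
    div_le_div_of_nonneg_right (mul_le_mul_of_nonneg_left hηF h3) (by norm_num)
  have hX'0 : 0 ≤ Real.sqrt 3 * (354 * (R ^ 2 * θK ^ 2)) / 3 := by positivity
  calc Real.sqrt 3 * (60 * θK ^ 2 + 6 * (49 * R ^ 2 * θK) * θK) / 3 * (A_B + A_B' * (2 * R + 2 * (L : ℝ) ^ h)) * (4 * (L : ℝ) ^ (2 * j))
      ≤ Real.sqrt 3 * (354 * (R ^ 2 * θK ^ 2)) / 3 * ((A_B + A_B') * (4 * R)) * (4 * (L : ℝ) ^ (2 * j)) :=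
        mul_le_mul_of_nonneg_right (mul_le_mul hX hbr hY0 hX'0) hL2j
    _ = 1888 * Real.sqrt 3 * (A_B + A_B') * (R ^ 3 * (L : ℝ) ^ (2 * j) * θK ^ 2) := by ring
    _ ≤ 1888 * Real.sqrt 3 * (A_B + A_B') * (N_R ^ 3 * (4 : ℝ) ^ p₀ * (151 : ℝ) ^ j * ((L : ℝ) ^ (3 * m) / (L : ℝ) ^ (7 * j)) * θ) :=
        mul_le_mul_of_nonneg_left hcore (by positivity)

/-- ★ **(η2) THE (r2)-DEFECT ROW**: `2θK·(2·16·169·R²·θK·A₁·R·L^(2j)) ≤ 10816·A₁·N_R³·4^{p₀}·151^j·(L^(3m)∕L^(7j))·θ` (`A₁ ≥ 0`). [folklore] -/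
theorem defect_row_le (hL : 1 ≤ L) (hθ : 0 ≤ θ) (hθx : θ ≤ x) (hθK0 : 0 ≤ θK) (hθK : θK ≤ (2 : ℝ) ^ p₀ * Real.sqrt ((L : ℝ)⁻¹) ^ j * θ)
    (hx : x ≤ (151 * (L : ℝ) ^ 2 * ((L : ℝ)⁻¹) ^ 19) ^ j) (hNR : 1 ≤ N_R) (hh : h = j + m) (hR : R = N_R * (L : ℝ) ^ (2 * j + h))
    {A₁ : ℝ} (hA₁ : 0 ≤ A₁) :
    2 * θK * (2 * 16 * 169 * R ^ 2 * θK * A₁ * R * (L : ℝ) ^ (2 * j))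
      ≤ 10816 * A₁ * (N_R ^ 3 * (4 : ℝ) ^ p₀ * (151 : ℝ) ^ j * ((L : ℝ) ^ (3 * m) / (L : ℝ) ^ (7 * j)) * θ) := by
  have hcore := core_R3 hL hθ hθx hθK0 hθK hx (by linarith) hh hR
  calc 2 * θK * (2 * 16 * 169 * R ^ 2 * θK * A₁ * R * (L : ℝ) ^ (2 * j)) = 10816 * A₁ * (R ^ 3 * (L : ℝ) ^ (2 * j) * θK ^ 2) := by ring
    _ ≤ 10816 * A₁ * (N_R ^ 3 * (4 : ℝ) ^ p₀ * (151 : ℝ) ^ j * ((L : ℝ) ^ (3 * m) / (L : ℝ) ^ (7 * j)) * θ) :=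
        mul_le_mul_of_nonneg_left hcore (by positivity)

/-- ★ **(η3) THE READING-ERROR ROW AT HEIGHT `j`**: `E_j := 100√3·(20L)^(2j)·(175·L^(2j)·θK)² ≤ 3062500√3·4^{p₀}·60400^j·θ∕L^(12j)` (`Γ = 60400 < 3^12`). [folklore] -/
theorem reading_row_le (hL : 1 ≤ L) (hθ : 0 ≤ θ) (hθx : θ ≤ x) (hθK0 : 0 ≤ θK) (hθK : θK ≤ (2 : ℝ) ^ p₀ * Real.sqrt ((L : ℝ)⁻¹) ^ j * θ)
    (hx : x ≤ (151 * (L : ℝ) ^ 2 * ((L : ℝ)⁻¹) ^ 19) ^ j) :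
    100 * Real.sqrt 3 * (20 * (L : ℝ)) ^ (2 * j) * (175 * (L : ℝ) ^ (2 * j) * θK) ^ 2
      ≤ 3062500 * Real.sqrt 3 * ((4 : ℝ) ^ p₀ * (60400 : ℝ) ^ j * (θ / (L : ℝ) ^ (12 * j))) := by
  have hcore := core_400 hL hθ hθx hθK0 hθK hx
  have h20 : (20 * (L : ℝ)) ^ (2 * j) = (400 : ℝ) ^ j * (L : ℝ) ^ (2 * j) := by
    rw [mul_pow, pow_mul, pow_mul]; norm_num
  calc 100 * Real.sqrt 3 * (20 * (L : ℝ)) ^ (2 * j) * (175 * (L : ℝ) ^ (2 * j) * θK) ^ 2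
      = 3062500 * Real.sqrt 3 * ((400 : ℝ) ^ j * (L : ℝ) ^ (6 * j) * θK ^ 2) := by
        rw [h20, show (L : ℝ) ^ (6 * j) = (L : ℝ) ^ (2 * j) * ((L : ℝ) ^ (2 * j)) ^ 2 by rw [← pow_mul, ← pow_add]; ring_nf]
        ring
    _ ≤ 3062500 * Real.sqrt 3 * ((4 : ℝ) ^ p₀ * (60400 : ℝ) ^ j * (θ / (L : ℝ) ^ (12 * j))) :=
        mul_le_mul_of_nonneg_left hcore (by positivity)

/-- ★ **(η3′) THE READING-ERROR ROW AT THE FAR HEIGHT `h = j + m`, WEIGHTED BY `L^(−2m)`**: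
`(L^(2m))⁻¹·E_h ≤ 3062500√3·4^{p₀}·60400^j·400^m·θ·L^(4m)∕L^(12j)`. [folklore] -/
theorem reading_row_far_le (hL : 1 ≤ L) (hθ : 0 ≤ θ) (hθx : θ ≤ x) (hθK0 : 0 ≤ θK) (hθK : θK ≤ (2 : ℝ) ^ p₀ * Real.sqrt ((L : ℝ)⁻¹) ^ j * θ)
    (hx : x ≤ (151 * (L : ℝ) ^ 2 * ((L : ℝ)⁻¹) ^ 19) ^ j) (hh : h = j + m) :
    ((L : ℝ) ^ (2 * m))⁻¹ * (100 * Real.sqrt 3 * (20 * (L : ℝ)) ^ (2 * h) * (175 * (L : ℝ) ^ (2 * h) * θK) ^ 2)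
      ≤ 3062500 * Real.sqrt 3 * ((4 : ℝ) ^ p₀ * (60400 : ℝ) ^ j * (400 : ℝ) ^ m * (θ * (L : ℝ) ^ (4 * m) / (L : ℝ) ^ (12 * j))) := by
  have hL1 : (1 : ℝ) ≤ L := by exact_mod_cast hL
  have hL0 : (0 : ℝ) < L := by linarith
  have hcore := core_400_far hL hθ hθx hθK0 hθK hx hh
  have h20 : (20 * (L : ℝ)) ^ (2 * h) = (400 : ℝ) ^ h * (L : ℝ) ^ (2 * h) := by
    rw [mul_pow, pow_mul, pow_mul]; norm_num
  have hE : 100 * Real.sqrt 3 * (20 * (L : ℝ)) ^ (2 * h) * (175 * (L : ℝ) ^ (2 * h) * θK) ^ 2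
      = 3062500 * Real.sqrt 3 * ((400 : ℝ) ^ h * (L : ℝ) ^ (6 * h) * θK ^ 2) := by
    rw [h20, show (L : ℝ) ^ (6 * h) = (L : ℝ) ^ (2 * h) * ((L : ℝ) ^ (2 * h)) ^ 2 by rw [← pow_mul, ← pow_add]; ring_nf]
    ring
  rw [hE]
  calc ((L : ℝ) ^ (2 * m))⁻¹ * (3062500 * Real.sqrt 3 * ((400 : ℝ) ^ h * (L : ℝ) ^ (6 * h) * θK ^ 2))
      ≤ ((L : ℝ) ^ (2 * m))⁻¹ * (3062500 * Real.sqrt 3 * ((4 : ℝ) ^ p₀ * (60400 : ℝ) ^ j * (400 : ℝ) ^ m *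
          (θ * (L : ℝ) ^ (6 * m) / (L : ℝ) ^ (12 * j)))) :=
        mul_le_mul_of_nonneg_left (mul_le_mul_of_nonneg_left hcore (by positivity)) (by positivity)
    _ = 3062500 * Real.sqrt 3 * ((4 : ℝ) ^ p₀ * (60400 : ℝ) ^ j * (400 : ℝ) ^ m * (θ * (L : ℝ) ^ (4 * m) / (L : ℝ) ^ (12 * j))) := by
        have key : (L : ℝ) ^ (6 * m) = (L : ℝ) ^ (2 * m) * (L : ℝ) ^ (4 * m) := by rw [← pow_add]; ring_nf
        rw [key]
        field_simp

/-- ★ **(η4) THE COST-DEFECT ROW**: `320·A_T·A₁·(169R²θK)²·R·L^(4j)∕L^j ≤ 9139520·A_T·A₁·N_R⁵·4^{p₀}·22801^j·(L^(5m)∕L^(17j))` (`Γ = 22801 < 3^17`;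
`A_T, A₁ ≥ 0`). [folklore] -/
theorem cost_defect_row_le (hL : 1 ≤ L) (hθ : 0 ≤ θ) (hθx : θ ≤ x) (hθK0 : 0 ≤ θK) (hθK : θK ≤ (2 : ℝ) ^ p₀ * Real.sqrt ((L : ℝ)⁻¹) ^ j * θ)
    (hx : x ≤ (151 * (L : ℝ) ^ 2 * ((L : ℝ)⁻¹) ^ 19) ^ j) (hNR : 1 ≤ N_R) (hh : h = j + m) (hR : R = N_R * (L : ℝ) ^ (2 * j + h))
    {A_T A₁ : ℝ} (hAT : 0 ≤ A_T) (hA₁ : 0 ≤ A₁) :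
    320 * A_T * A₁ * (169 * R ^ 2 * θK) ^ 2 * R * (L : ℝ) ^ (4 * j) / (L : ℝ) ^ j
      ≤ 9139520 * A_T * A₁ * (N_R ^ 5 * (4 : ℝ) ^ p₀ * (22801 : ℝ) ^ j * ((L : ℝ) ^ (5 * m) / (L : ℝ) ^ (17 * j))) := by
  have hL1 : (1 : ℝ) ≤ L := by exact_mod_cast hL
  have hL0 : (0 : ℝ) < L := by linarith
  have hcore := core_R5 hL hθ hθx hθK0 hθK hx (by linarith) hh hR
  have hid : 320 * A_T * A₁ * (169 * R ^ 2 * θK) ^ 2 * R * (L : ℝ) ^ (4 * j) / (L : ℝ) ^ j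
      = 9139520 * A_T * A₁ * (R ^ 5 * (L : ℝ) ^ (3 * j) * θK ^ 2) := by
    have key : (L : ℝ) ^ (4 * j) = (L : ℝ) ^ (3 * j) * (L : ℝ) ^ j := by rw [← pow_add]; ring_nf
    rw [key]
    field_simp
    ring
  rw [hid]
  exact mul_le_mul_of_nonneg_left hcore (by positivity)

/-- ★ **(η5) THE (P″)-ERROR ROW**: with `R = N_R·L^(2j+h)` and `1536√3·2^{p₀}·A_S ≤ N_R` (`A_S ≥ 0`): `24√3·A_S·θK·L^(2j+h)∕R ≤ θ∕64`
(`θK ≤ 2^{p₀}θ` since `√(L⁻¹)^j ≤ 1`). [folklore] -/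
theorem profile_error_row_le (hL : 1 ≤ L) (hθ : 0 ≤ θ) (hθK : θK ≤ (2 : ℝ) ^ p₀ * Real.sqrt ((L : ℝ)⁻¹) ^ j * θ)
    (hR : R = N_R * (L : ℝ) ^ (2 * j + h)) {A_S : ℝ} (hAS : 0 ≤ A_S) (hNR : 1536 * Real.sqrt 3 * (2 : ℝ) ^ p₀ * A_S ≤ N_R) (hNR0 : 0 < N_R) :
    24 * Real.sqrt 3 * A_S * θK * (L : ℝ) ^ (2 * j + h) / R ≤ θ / 64 := by
  have hL1 : (1 : ℝ) ≤ L := by exact_mod_cast hL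
  have hL0 : (0 : ℝ) < L := by linarith
  have hLpow : (0 : ℝ) < (L : ℝ) ^ (2 * j + h) := by positivity
  -- `θK ≤ 2^p₀ θ`
  have hs1 : Real.sqrt ((L : ℝ)⁻¹) ^ j ≤ 1 :=
    pow_le_one₀ (Real.sqrt_nonneg _) (Real.sqrt_le_one.mpr (inv_le_one_of_one_le₀ hL1))
  have h2 : (0 : ℝ) ≤ (2 : ℝ) ^ p₀ := by positivity
  have hθK' : θK ≤ (2 : ℝ) ^ p₀ * θ := by
    calc θK ≤ (2 : ℝ) ^ p₀ * Real.sqrt ((L : ℝ)⁻¹) ^ j * θ := hθK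
      _ ≤ (2 : ℝ) ^ p₀ * 1 * θ := by gcongr
      _ = (2 : ℝ) ^ p₀ * θ := by ring
  -- `L^(2j+h)/R = 1/N_R`
  have hfrac : 24 * Real.sqrt 3 * A_S * θK * (L : ℝ) ^ (2 * j + h) / R = 24 * Real.sqrt 3 * A_S * θK / N_R := by
    rw [hR]; field_simp
  rw [hfrac, div_le_div_iff₀ hNR0 (by norm_num : (0 : ℝ) < 64)]
  have h3 : 0 ≤ Real.sqrt 3 := Real.sqrt_nonneg 3
  calc 24 * Real.sqrt 3 * A_S * θK * 64 ≤ 24 * Real.sqrt 3 * A_S * ((2 : ℝ) ^ p₀ * θ) * 64 := by gcongr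
    _ = θ * (1536 * Real.sqrt 3 * (2 : ℝ) ^ p₀ * A_S) := by ring
    _ ≤ θ * N_R := mul_le_mul_of_nonneg_left hNR hθ

end Rows

/-! ## §3 Smallness: every row is eventually below any `ε > 0` -/

/-- ★ **GEOMETRIC DECAY BEATS ANY CONSTANT**: for `0 ≤ q < 1`, any `A` and `ε > 0` there is `j₀` with `A·q^j ≤ ε` for all `j > j₀`. [folklore] -/
theorem exists_forall_mul_pow_le (A : ℝ) {q : ℝ} (hq0 : 0 ≤ q) (hq1 : q < 1) {ε : ℝ} (hε : 0 < ε) :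
    ∃ j₀ : ℕ, ∀ j : ℕ, j₀ < j → A * q ^ j ≤ ε := by
  rcases le_or_gt A 0 with hA | hA
  · exact ⟨0, fun j _ => (mul_nonpos_of_nonpos_of_nonneg hA (pow_nonneg hq0 j)).trans hε.le⟩
  · have ht := tendsto_pow_atTop_nhds_zero_of_lt_one hq0 hq1
    obtain ⟨j₀, hj₀⟩ := (ht.eventually (ge_mem_nhds (div_pos hε hA))).exists_forall_of_atTop
    refine ⟨j₀, fun j hj => ?_⟩
    have := hj₀ j hj.le
    calc A * q ^ j ≤ A * (ε / A) := mul_le_mul_of_nonneg_left this hA.le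
      _ = ε := mul_div_cancel₀ ε hA.ne'

/-- **`Γ∕L^a < 1` for `L ≥ 3` and `Γ < 3^a`** (`Γ ≥ 0`). [folklore] -/
theorem div_pow_lt_one {L a : ℕ} (hL : 3 ≤ L) {Γ : ℝ} (hΓ : Γ < (3 : ℝ) ^ a) : Γ / (L : ℝ) ^ a < 1 := by
  have hL3 : (3 : ℝ) ≤ L := by exact_mod_cast hL
  have hpow : (3 : ℝ) ^ a ≤ (L : ℝ) ^ a := pow_le_pow_left₀ (by norm_num) hL3 a
  have hpos : (0 : ℝ) < (L : ℝ) ^ a := lt_of_lt_of_le (by positivity) hpow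
  rw [div_lt_one hpos]
  exact hΓ.trans_le hpow

/-- ★ **THE SMALLNESS TEMPLATE**: for `L ≥ 3`, `0 ≤ Γ < 3^a`, any `C` and `E` (the `m`-dependent factor, e.g. `N·L^(e·m)·400^m`) and `ε > 0` there is `j₀` with
`C·E·Γ^j∕L^(a·j) ≤ ε` for all `j > j₀` (`Γ^j∕L^(a·j) = (Γ∕L^a)^j`). [folklore] -/
theorem exists_forall_row_le {L a : ℕ} (hL : 3 ≤ L) {Γ : ℝ} (hΓ0 : 0 ≤ Γ) (hΓ : Γ < (3 : ℝ) ^ a) (C E : ℝ) {ε : ℝ} (hε : 0 < ε) :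
    ∃ j₀ : ℕ, ∀ j : ℕ, j₀ < j → C * E * Γ ^ j / (L : ℝ) ^ (a * j) ≤ ε := by
  have hL3 : (3 : ℝ) ≤ L := by exact_mod_cast hL
  have hL0 : (0 : ℝ) < L := by linarith
  obtain ⟨j₀, hj₀⟩ := exists_forall_mul_pow_le (C * E) (div_nonneg hΓ0 (by positivity)) (div_pow_lt_one hL hΓ) hε
  refine ⟨j₀, fun j hj => ?_⟩
  have key : C * E * Γ ^ j / (L : ℝ) ^ (a * j) = C * E * (Γ / (L : ℝ) ^ a) ^ j := by
    rw [div_pow, ← pow_mul]; ring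
  rw [key]
  exact hj₀ j hj

/-- The three numeric facts of record: `151 < 3^7`, `60400 < 3^12`, `22801 < 3^17`. [folklore] -/
theorem gamma_facts : (151 : ℝ) < (3 : ℝ) ^ 7 ∧ (60400 : ℝ) < (3 : ℝ) ^ 12 ∧ (22801 : ℝ) < (3 : ℝ) ^ 17 := by norm_num

/-- ★ **(η1)∕(η2) SMALLNESS**: `C·N·L^(3m)·151^j∕L^(7j) ≤ ε` for `j > j₀(L, C, N, m, ε)` (`L ≥ 3`). [folklore] -/
theorem exists_forall_row151_le {L : ℕ} (hL : 3 ≤ L) (C N : ℝ) (m : ℕ) {ε : ℝ} (hε : 0 < ε) :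
    ∃ j₀ : ℕ, ∀ j : ℕ, j₀ < j → C * (N * (L : ℝ) ^ (3 * m)) * (151 : ℝ) ^ j / (L : ℝ) ^ (7 * j) ≤ ε :=
  exists_forall_row_le hL (by norm_num) gamma_facts.1 C _ hε

/-- ★ **(η3) SMALLNESS**: `C·(400^m·L^(4m))·60400^j∕L^(12j) ≤ ε` for `j > j₀` (`L ≥ 3`). [folklore] -/
theorem exists_forall_row60400_le {L : ℕ} (hL : 3 ≤ L) (C : ℝ) (m : ℕ) {ε : ℝ} (hε : 0 < ε) :
    ∃ j₀ : ℕ, ∀ j : ℕ, j₀ < j → C * ((400 : ℝ) ^ m * (L : ℝ) ^ (4 * m)) * (60400 : ℝ) ^ j / (L : ℝ) ^ (12 * j) ≤ ε :=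
  exists_forall_row_le hL (by norm_num) gamma_facts.2.1 C _ hε

/-- ★ **(η4) SMALLNESS**: `C·(N·L^(5m))·22801^j∕L^(17j) ≤ ε` for `j > j₀` (`L ≥ 3`). [folklore] -/
theorem exists_forall_row22801_le {L : ℕ} (hL : 3 ≤ L) (C N : ℝ) (m : ℕ) {ε : ℝ} (hε : 0 < ε) :
    ∃ j₀ : ℕ, ∀ j : ℕ, j₀ < j → C * (N * (L : ℝ) ^ (5 * m)) * (22801 : ℝ) ^ j / (L : ℝ) ^ (17 * j) ≤ ε :=
  exists_forall_row_le hL (by norm_num) gamma_facts.2.2 C _ hε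

end Summit.QuantumFields.YangMills.Theorems.CovariantDischargeDoorExponentRows

end
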